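/-
Copyright (c) 2026. All rights reserved.
Released under Apache 2.0 license as described in the file LICENSE.
Authors: abc-iut cell, campaign-S prover seat abc-iut-S8 (wave 2).
-/
import Literature.IUT.LogVolume.LogVolumeEstimates
import Literature.IUT.LogVolume.TensorPacketLogHolds
import HarnessLib

/-!
# [IUTchIV] Prop. 1.4 (iv) — proved (assembly)

"(iv) If `p > 2` and `e_i = 1` for all `i ∈ I`, then `φ((R_I)^∼) ⊆ (R_I)^∼`, and `μ^log((R_I)^∼) = 0`"
([IUTchIV] Prop. 1.4 (iv), kurims p. 13).  The inclusion clause is Prop. 1.2 (iv), discharged as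
`prop12iv_holds` (`TensorPacketLogHolds.lean`, abc-iut-S6, over abc-iut-S5's `prop11_holds`); the volume
clause is the normalisation of the packet log-volume (`LogVolumeEstimates.prop14iv_of_prop12iv`,
abc-iut-S8).  Hence the typed statement `Prop14iv` holds: `Prop14iv_holds`.  (Part (iii) is assembled in
`LogVolumeEstimatesHolds.lean`.)  Nothing here bears on the disputed [IUTchIII] Cor. 3.12.
-/

noncomputable section

namespace Literature.IUT.LogVolume

variable (p : ℕ) [Fact p.Prime]
variable {I : Type} [Fintype I] [DecidableEq I]
variable (k : I → Type) [∀ i, NontriviallyNormedField (k i)] [∀ i, NormedAlgebra ℚ_[p] (k i)]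
  [∀ i, IsUltrametricDist (k i)] [∀ i, ProperSpace (k i)]
variable {J : Type} [Fintype J] (L : J → Type) [∀ j, NontriviallyNormedField (L j)]
  [∀ j, NormedAlgebra ℚ_[p] (L j)] [∀ j, IsUltrametricDist (L j)] [∀ j, ProperSpace (L j)]
  [∀ j, MeasurableSpace (L j)] [∀ j, BorelSpace (L j)]
variable (ψ : PacketAlgebra p k ≃ₐ[ℚ_[p]] (Π j, L j))

/-- **[IUTchIV] Prop. 1.4 (iv) holds**: for `p > 2`, `e_i = 1` (all `i`), every `φ` preserves
`(R_I)^∼`, and `μ^log((R_I)^∼) = 0`. [cite: Mochizuki2012, IUTchIV Prop. 1.4 (iv) p. 13] -/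
theorem Prop14iv_holds : Prop14iv p k L ψ :=
  prop14iv_of_prop12iv p k L ψ (prop12iv_holds p k)

end Literature.IUT.LogVolume

end
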